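import Mathlib
import Literature.Computability.AlgebraicComplexity.DepthThreeRankBound
import Summits.ValiantsHypothesis.ValiantsHypothesis.Theorems.MonotoneRestorationOrbitRestorationQPLevelStructureB
import Summits.ValiantsHypothesis.ValiantsHypothesis.Theorems.MonotoneRestorationMixingScaleDefs
import HarnessLib

/-!
# M4c of the line `mixing-scale`, I: the ORBIT DATUM — a `Setting` without separation, with even-invariant class sums (ORBIT currency)

Route MonotoneRestoration, crux `OrbitRestorationQP` (stmt-ValiantsHypothesis-18293), line `mixing-scale` (val-idea-12), registered stub **M4c**
`stub_polyScaleStructure` (Theorem S′).  Namespace `Summit.ValiantsHypothesis.ValiantsHypothesis.Theorems.OrbitRestorationQPMixingScale.OrbitDatum`.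

This is the port of `LevelStructure.Setting` (`…LevelAction.lean`) and of `…LevelStructureB.lean` to the datum the line `mixing-scale`
produces: a matrix-symmetric `f`, a clean minimal representation `R`, a labelling `cl` of plain rank-diameter `Θ`, and — INSTEAD of the
separation `hsep` of the landed `Setting` — the hypothesis that every EVEN row/column renaming FIXES every class sum (the conclusion of
M3 `stub_orbitClassSums` for the orbit-linked classes).  Two uses of separation in the landed pipeline concern ODD renamings and are
repaired here:

* (G1) `LevelStructureB.mact_Fall` (the product `Fall` of the distinct nonzero cluster sums is fixed by EVERY `mact σ τ`, used by
  `exists_support`): with even-invariance only, `Fall` is `𝔄_n × 𝔄_n`-fixed (`mact_Fall_of_sign`), and the product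
  `Fall4 := ∏_{(ε₁,ε₂) ∈ {±1}²} mact (r ε₁) (r ε₂) Fall` over coset representatives (`r 1 = 1`, `r (−1) = ` a fixed transposition) is fixed
  by the WHOLE matrix action (`mact_Fall4`), has degree `≤ 4·m·D`, and is divisible by every class sum; the support lemma
  `exists_support`, the stability of the normalised linear factor multisets `act_linNrm_eq` and the scalar action `exists_C_mul_linProd`
  port VERBATIM with `Fall4` and the side condition `4·m·D < C(n, c+2)`.
* (G2) is repaired in part II (`…MixingScaleOrbitStructure.lean`, global untwisting by minimality).

Everything is proved modulo the named fact `depthThree_rankBound`, carried BY NAME where the landed lemmas carry it.  Honest framing: part of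
one L-sized input of a tier-B rung; nothing here bears on VP ≠ VNP. [cite: KarninShpilka2009, §3; SaxenaSeshadhri2013, Theorem 5;
DixonMortimer1996, Thm 5.2B]
-/

noncomputable section

open MvPolynomial Equiv Literature.Computability.AlgebraicComplexity UniqueFactorizationMonoid

-- `Summit.ValiantsHypothesis.ValiantsHypothesis.…` is the tree's single-conjunct layout (Sub = Summit).
set_option linter.dupNamespace false

namespace Summit.ValiantsHypothesis.ValiantsHypothesis.Theorems.OrbitRestorationQPMixingScale

open RankDistance LinNL LinearSubalgebra ProductAction LevelRep LevelStructure

variable {n : ℕ}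

/-! ### Products of matrix actions -/

/-- `mact σ τ ∘ mact σ' τ' = mact (σσ') (ττ')`. [folklore] -/
theorem mact_mact (σ τ σ' τ' : Perm (Fin n)) (p : MvPolynomial (Fin n × Fin n) ℂ) :
    mact σ τ (mact σ' τ' p) = mact (σ * σ') (τ * τ') p := by
  rw [mact_apply, mact_apply, mact_apply, rename_rename]
  rfl

/-! ### The orbit datum -/

/-- The standing data of Theorem S′ at one level: a matrix-symmetric `f`, a clean minimal representation, a labelling of its terms of plain
rank-diameter `Θ` whose class sums are FIXED by every even row/column renaming (no separation), and `n > 8`. [folklore] -/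
structure OrbitDatum (n D : ℕ) where
  /-- the polynomial -/
  f : MvPolynomial (Fin n × Fin n) ℂ
  hsym : ∀ σ τ : Perm (Fin n), mact σ τ f = f
  /-- its clean representation -/
  R : CleanRep f D
  /-- the labelling and its diameter -/
  cl : Fin R.m → Fin R.m
  Θ : ℕ
  hdiam : ∀ i j, cl i = cl j → rdist (R.L i) (R.L j) ≤ Θ
  hfix : ∀ (a : Fin R.m) (σ τ : Perm (Fin n)), Perm.sign σ = 1 → Perm.sign τ = 1 →
    mact σ τ (R.clusterSum cl a) = R.clusterSum cl a
  hn8 : 8 < n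

namespace OrbitDatum

variable {D : ℕ} (O : OrbitDatum n D)

/-- The class sum of label `a`. [folklore] -/
def F (a : Fin O.R.m) : MvPolynomial (Fin n × Fin n) ℂ := O.R.clusterSum O.cl a

/-- The labels with nonempty fibre. [folklore] -/
def labs : Finset (Fin O.R.m) := Finset.univ.image O.cl

/-- The fibre of a label. [folklore] -/
def fibre (a : Fin O.R.m) : Finset (Fin O.R.m) := Finset.univ.filter fun i => O.cl i = a

/-- Labels in `labs` have nonempty fibre. [folklore] -/
theorem fibre_nonempty {a : Fin O.R.m} (ha : a ∈ O.labs) : (O.fibre a).Nonempty := by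
  obtain ⟨i, -, hi⟩ := Finset.mem_image.1 ha
  exact ⟨i, by simp [fibre, hi]⟩

/-- Class sums of labels in `labs` are nonzero. [folklore] -/
theorem F_ne_zero {a : Fin O.R.m} (ha : a ∈ O.labs) : O.F a ≠ 0 := by
  obtain ⟨i, -, hi⟩ := Finset.mem_image.1 ha
  exact O.R.clusterSum_ne_zero O.cl ⟨i, hi⟩

/-- A label with nonzero class sum is in `labs`. [folklore] -/
theorem mem_labs_of_F_ne_zero {a : Fin O.R.m} (ha : O.F a ≠ 0) : a ∈ O.labs := by
  by_contra h
  refine ha (O.R.clusterSum_eq_zero O.cl fun ⟨i, hi⟩ => h ?_)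
  exact Finset.mem_image.2 ⟨i, Finset.mem_univ i, hi⟩

/-- A label outside `labs` has zero class sum. [folklore] -/
theorem F_eq_zero_of_not_mem {a : Fin O.R.m} (ha : a ∉ O.labs) : O.F a = 0 := by
  by_contra h; exact ha (O.mem_labs_of_F_ne_zero h)

/-- `f = Σ_{a ∈ labs} F a`. [folklore] -/
theorem sum_F : ∑ a ∈ O.labs, O.F a = O.f := by
  have h := O.R.sum_clusterSum O.cl
  rw [← Finset.sum_subset (Finset.subset_univ O.labs)] at h
  · exact h
  · intro a _ ha
    exact O.R.clusterSum_eq_zero O.cl fun ⟨i, hi⟩ => ha (Finset.mem_image.2 ⟨i, Finset.mem_univ i, hi⟩)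

/-- Even renamings fix every class sum. [folklore] -/
theorem mact_F_even (a : Fin O.R.m) {σ τ : Perm (Fin n)} (hσ : Perm.sign σ = 1) (hτ : Perm.sign τ = 1) :
    mact σ τ (O.F a) = O.F a := O.hfix a σ τ hσ hτ

/-- Even row permutations fix every class sum. [folklore] -/
theorem rowFix_F (a : Fin O.R.m) : ∀ ρ : Perm (Fin n), Perm.sign ρ = 1 → vact (K := ℂ) rowHom ρ (O.F a) = O.F a :=
  fun ρ hρ => by rw [vact_rowHom_eq]; exact O.mact_F_even a hρ Perm.sign_one

/-- Even column permutations fix every class sum. [folklore] -/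
theorem colFix_F (a : Fin O.R.m) : ∀ ρ : Perm (Fin n), Perm.sign ρ = 1 → vact (K := ℂ) colHom ρ (O.F a) = O.F a :=
  fun ρ hρ => by rw [vact_colHom_eq]; exact O.mact_F_even a Perm.sign_one hρ

/-- Class sums have total degree `≤ D`. [folklore] -/
theorem totalDegree_F_le (a : Fin O.R.m) : (O.F a).totalDegree ≤ D := by
  unfold F CleanRep.clusterSum CleanRep.T
  refine (totalDegree_finsetSum _ _).trans (Finset.sup_le fun i _ => ?_)
  refine (totalDegree_mul _ _).trans ?_
  rw [totalDegree_C, zero_add]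
  refine (MvPolynomial.totalDegree_multiset_prod _).trans ?_
  have : ((O.R.L i).map totalDegree) = (O.R.L i).map fun _ => 1 := Multiset.map_congr rfl fun q hq => O.R.hdeg i q hq
  rw [this, Multiset.map_const', Multiset.sum_replicate, smul_eq_mul, mul_one]
  exact O.R.hcard i

/-! ### The product of the nonzero class sums and its four translates -/

/-- The product of the distinct nonzero class sums. [folklore] -/
def Fall : MvPolynomial (Fin n × Fin n) ℂ := ∏ P ∈ O.labs.image O.F, P

/-- `Fall ≠ 0`. [folklore] -/
theorem Fall_ne_zero : O.Fall ≠ 0 := by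
  rw [Fall, Finset.prod_ne_zero_iff]
  intro P hP
  obtain ⟨a, ha, rfl⟩ := Finset.mem_image.1 hP
  exact O.F_ne_zero ha

/-- `F a ∣ Fall` for `a ∈ labs`. [folklore] -/
theorem F_dvd_Fall {a : Fin O.R.m} (ha : a ∈ O.labs) : O.F a ∣ O.Fall :=
  Finset.dvd_prod_of_mem _ (Finset.mem_image_of_mem _ ha)

/-- Even renamings fix `Fall`. [folklore] -/
theorem mact_Fall_even {σ τ : Perm (Fin n)} (hσ : Perm.sign σ = 1) (hτ : Perm.sign τ = 1) : mact σ τ O.Fall = O.Fall := by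
  rw [Fall, map_prod]
  refine Finset.prod_congr rfl fun P hP => ?_
  obtain ⟨a, -, rfl⟩ := Finset.mem_image.1 hP
  exact O.mact_F_even a hσ hτ

/-- `mact σ τ Fall` depends only on the signs of `σ` and `τ`. [folklore] -/
theorem mact_Fall_of_sign {σ τ σ' τ' : Perm (Fin n)} (hσ : Perm.sign σ = Perm.sign σ') (hτ : Perm.sign τ = Perm.sign τ') :
    mact σ τ O.Fall = mact σ' τ' O.Fall := by
  have h1 : Perm.sign (σ'⁻¹ * σ) = 1 := by rw [map_mul, map_inv, hσ, inv_mul_cancel]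
  have h2 : Perm.sign (τ'⁻¹ * τ) = 1 := by rw [map_mul, map_inv, hτ, inv_mul_cancel]
  conv_rhs => rw [← O.mact_Fall_even h1 h2, mact_mact, mul_inv_cancel_left, mul_inv_cancel_left]

/-- `deg Fall ≤ m · D`. [folklore] -/
theorem totalDegree_Fall_le : O.Fall.totalDegree ≤ O.R.m * D := by
  classical
  unfold Fall
  refine (totalDegree_finsetProd _ _).trans ?_
  calc ∑ P ∈ O.labs.image O.F, P.totalDegree ≤ ∑ P ∈ O.labs.image O.F, D := Finset.sum_le_sum fun P hP => by
        obtain ⟨a, -, rfl⟩ := Finset.mem_image.1 hP; exact O.totalDegree_F_le a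
    _ = (O.labs.image O.F).card * D := by rw [Finset.sum_const, smul_eq_mul]
    _ ≤ O.R.m * D := Nat.mul_le_mul_right _ (Finset.card_image_le.trans (Finset.card_image_le.trans (by simp)))

/-- A fixed transposition (of `0` and `1`; `n > 8`). [folklore] -/
def s₀ : Perm (Fin n) := swap (⟨0, by have := O.hn8; omega⟩ : Fin n) ⟨1, by have := O.hn8; omega⟩

/-- `sign s₀ = −1`. [folklore] -/
theorem sign_s₀ : Perm.sign O.s₀ = -1 := by
  rw [s₀, Perm.sign_swap]
  simp [Fin.ext_iff]

/-- Coset representatives by sign: `r 1 = 1`, `r (−1) = s₀`. [folklore] -/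
def r (ε : ℤˣ) : Perm (Fin n) := if ε = 1 then 1 else O.s₀

/-- `sign (r ε) = ε`. [folklore] -/
theorem sign_r (ε : ℤˣ) : Perm.sign (O.r ε) = ε := by
  rcases Int.units_eq_one_or ε with h | h
  · subst h; simp [r]
  · subst h; rw [r, if_neg (by decide), sign_s₀]

/-- The product of the four translates of `Fall` by the coset representatives of `𝔄_n × 𝔄_n` in `𝔖_n × 𝔖_n`. [folklore] -/
def Fall4 : MvPolynomial (Fin n × Fin n) ℂ := ∏ e : ℤˣ × ℤˣ, mact (O.r e.1) (O.r e.2) O.Fall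

/-- `Fall4 ≠ 0`. [folklore] -/
theorem Fall4_ne_zero : O.Fall4 ≠ 0 := by
  rw [Fall4, Finset.prod_ne_zero_iff]
  intro e _
  exact (map_ne_zero_iff _ (mact _ _).injective).2 O.Fall_ne_zero

/-- `mact 1 1` is the identity. [folklore] -/
theorem mact_one_one (p : MvPolynomial (Fin n × Fin n) ℂ) : mact (1 : Perm (Fin n)) 1 p = p := by
  rw [mact_apply]
  have : (fun q : Fin n × Fin n => (((1 : Perm (Fin n)) q.1), ((1 : Perm (Fin n)) q.2))) = id := funext fun q => by simp
  rw [this, rename_id]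
  rfl

/-- `Fall ∣ Fall4` (the factor at the trivial coset). [folklore] -/
theorem Fall_dvd_Fall4 : O.Fall ∣ O.Fall4 := by
  have h := Finset.dvd_prod_of_mem (fun e : ℤˣ × ℤˣ => mact (O.r e.1) (O.r e.2) O.Fall) (Finset.mem_univ ((1, 1) : ℤˣ × ℤˣ))
  have h1 : mact (O.r 1) (O.r 1) O.Fall = O.Fall := by rw [r, if_pos rfl]; exact mact_one_one _
  rw [h1] at h
  exact h

/-- `F a ∣ Fall4` for `a ∈ labs`. [folklore] -/
theorem F_dvd_Fall4 {a : Fin O.R.m} (ha : a ∈ O.labs) : O.F a ∣ O.Fall4 := (O.F_dvd_Fall ha).trans O.Fall_dvd_Fall4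

/-- **`Fall4` is fixed by the WHOLE matrix action** (it permutes the four coset translates of `Fall`). [folklore] -/
theorem mact_Fall4 (σ τ : Perm (Fin n)) : mact σ τ O.Fall4 = O.Fall4 := by
  rw [Fall4, map_prod]
  -- each translate is moved to the translate with the multiplied signs
  have hmove : ∀ e : ℤˣ × ℤˣ, mact σ τ (mact (O.r e.1) (O.r e.2) O.Fall) =
      mact (O.r (Perm.sign σ * e.1)) (O.r (Perm.sign τ * e.2)) O.Fall := by
    intro e
    rw [mact_mact]
    exact O.mact_Fall_of_sign (by rw [map_mul, sign_r, sign_r]) (by rw [map_mul, sign_r, sign_r])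
  simp_rw [hmove]
  exact Fintype.prod_equiv ((Equiv.mulLeft (Perm.sign σ)).prodCongr (Equiv.mulLeft (Perm.sign τ))) _ _ fun e => rfl

/-- Rows fix `Fall4`. [folklore] -/
theorem row_Fall4 (ρ : Perm (Fin n)) : vact (K := ℂ) rowHom ρ O.Fall4 = O.Fall4 := by
  rw [vact_rowHom_eq]; exact O.mact_Fall4 ρ 1

/-- Columns fix `Fall4`. [folklore] -/
theorem col_Fall4 (ρ : Perm (Fin n)) : vact (K := ℂ) colHom ρ O.Fall4 = O.Fall4 := by
  rw [vact_colHom_eq]; exact O.mact_Fall4 1 ρ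

/-- `deg Fall4 ≤ 4 · m · D`. [folklore] -/
theorem totalDegree_Fall4_le : O.Fall4.totalDegree ≤ 4 * (O.R.m * D) := by
  classical
  unfold Fall4
  refine (totalDegree_finsetProd _ _).trans ?_
  calc ∑ e : ℤˣ × ℤˣ, (mact (O.r e.1) (O.r e.2) O.Fall).totalDegree ≤ ∑ _e : ℤˣ × ℤˣ, O.R.m * D :=
        Finset.sum_le_sum fun e _ => by rw [totalDegree_mact]; exact O.totalDegree_Fall_le
    _ = 4 * (O.R.m * D) := by
        rw [Finset.sum_const, smul_eq_mul, Finset.card_univ, Fintype.card_prod, Fintype.card_units_int]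

/-! ### Supports of the degree-one divisors of `Fall4` (port of `LevelStructureB.exists_support`) -/

/-- **Every degree-`1` divisor of `Fall4` has a small support** for a local action fixing `Fall4`: it is fixed by every permutation fixing
pointwise some set of fewer than `c + 2` indices. [cite: DixonMortimer1996, Thm 5.2B; DawarWilsenach2025, Def. 6.1] -/
theorem exists_support {g : Perm (Fin n) →* Perm (Fin n × Fin n)} (hg : IsLocal g)
    (hinv : ∀ ρ : Perm (Fin n), vact (K := ℂ) g ρ O.Fall4 = O.Fall4) {c : ℕ} (hc1 : 4 * (O.R.m * D) < n.choose (c + 2))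
    (hc2 : 4 * (c + 2) ≤ n) (hc3 : c + 7 ≤ n) {q : MvPolynomial (Fin n × Fin n) ℂ} (hq1 : q.totalDegree = 1) (hdvd : q ∣ O.Fall4) :
    ∃ Y : Finset (Fin n), Y.card < c + 2 ∧ ∀ ρ : Perm (Fin n), (∀ x ∈ Y, ρ x = x) → vact (K := ℂ) g ρ q = q := by
  classical
  -- the images of the line of `q` are lines of degree-one factors of `Fall4`
  set Tq : Finset (MvPolynomial (Fin n × Fin n) ℂ) := ((linPart O.Fall4).map nrm).toFinset with hTq
  have hsub : (Set.range fun ρ : Perm (Fin n) => nrm (vact (K := ℂ) g ρ q)) ⊆ ↑Tq := by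
    rintro _ ⟨ρ, rfl⟩
    have hd : vact (K := ℂ) g ρ q ∣ O.Fall4 := by rw [← hinv ρ]; exact map_dvd _ hdvd
    have hdeg : (vact (K := ℂ) g ρ q).totalDegree = 1 := by rw [vact_apply, totalDegree_rename_equiv]; exact hq1
    have hirr : Irreducible (vact (K := ℂ) g ρ q) := (RankBoundBridge.prime_of_totalDegree_eq_one hdeg).irreducible
    obtain ⟨q', hq', hassoc⟩ := exists_mem_factors_of_dvd O.Fall4_ne_zero hirr hd
    have hq'1 : q'.totalDegree = 1 := by rw [← totalDegree_eq_of_associated hassoc, hdeg]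
    rw [hTq, Finset.mem_coe, Multiset.mem_toFinset]
    exact Multiset.mem_map.2 ⟨q', Multiset.mem_filter.2 ⟨hq', hq'1⟩, (nrm_eq_of_associated hassoc).symm⟩
  have hfin : (Set.range fun ρ : Perm (Fin n) => nrm (vact (K := ℂ) g ρ q)).Finite := (Finset.finite_toSet _).subset hsub
  have hlt : (Set.range fun ρ : Perm (Fin n) => nrm (vact (K := ℂ) g ρ q)).ncard < n.choose (c + 2) := by
    refine lt_of_le_of_lt ?_ hc1
    calc (Set.range fun ρ : Perm (Fin n) => nrm (vact (K := ℂ) g ρ q)).ncard ≤ (↑Tq : Set _).ncard :=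
          Set.ncard_le_ncard hsub (Finset.finite_toSet _)
      _ = Tq.card := Set.ncard_coe_finset _
      _ ≤ Multiset.card (linPart O.Fall4) := by
          rw [hTq]; exact (Multiset.toFinset_card_le _).trans (by rw [Multiset.card_map])
      _ ≤ O.Fall4.totalDegree := card_linPart_le O.Fall4_ne_zero
      _ ≤ 4 * (O.R.m * D) := O.totalDegree_Fall4_le
  obtain ⟨Y, hYc, hY⟩ := altFixLine_of_ncard_lt (vact (K := ℂ) g) O.hn8 (by omega) hc2 q hfin hlt
  have hq0 : q ≠ 0 := by rintro rfl; rw [totalDegree_zero] at hq1; exact zero_ne_one hq1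
  have hfix := fix_of_fixLine (vact (K := ℂ) g) (Y := Y) (by omega) hq0 hY
  exact ⟨Y, hYc, symFix_of_altFix_affine hg (by omega) hq1.le hfix⟩

/-! ### Stability of the normalised linear factor multisets (port of `LevelStructureB`) -/

/-- The normalised multiset of the degree-one factors of the class sum of `a`. [folklore] -/
def linNrm (a : Fin O.R.m) : Multiset (MvPolynomial (Fin n × Fin n) ℂ) := (linPart (O.F a)).map nrm

/-- `linNrm a` is normalised. [folklore] -/
theorem isNormalised_linNrm (a : Fin O.R.m) : IsNormalised (O.linNrm a) := fun q hq => by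
  obtain ⟨q', -, rfl⟩ := Multiset.mem_map.1 hq; exact nrm_nrm q'

/-- Members of `linNrm a` have degree `1` and divide `F a`. [folklore] -/
theorem mem_linNrm {a : Fin O.R.m} (ha : a ∈ O.labs) {p : MvPolynomial (Fin n × Fin n) ℂ} (hp : p ∈ O.linNrm a) :
    p.totalDegree = 1 ∧ p ∣ O.F a := by
  obtain ⟨q, hq, rfl⟩ := Multiset.mem_map.1 hp
  refine ⟨by rw [totalDegree_nrm]; exact totalDegree_of_mem_linPart hq, (nrm_associated q).dvd.trans ?_⟩
  exact (Multiset.dvd_prod (Multiset.mem_of_le (Multiset.filter_le _ _) hq)).trans (factors_prod (O.F_ne_zero ha)).dvd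

/-- **The normalised linear factor multiset of a nonzero class sum is stable under every permutation of a local action** whose even
elements fix the class sum and which fixes `Fall4`. [folklore] -/
theorem act_linNrm_eq {g : Perm (Fin n) →* Perm (Fin n × Fin n)} (hg : IsLocal g)
    (hfixF : ∀ a, ∀ ρ : Perm (Fin n), Perm.sign ρ = 1 → vact (K := ℂ) g ρ (O.F a) = O.F a)
    (hinv : ∀ ρ : Perm (Fin n), vact (K := ℂ) g ρ O.Fall4 = O.Fall4) {c : ℕ} (hc1 : 4 * (O.R.m * D) < n.choose (c + 2))
    (hc2 : 4 * (c + 2) ≤ n) (hc3 : c + 7 ≤ n) {a : Fin O.R.m} (ha : a ∈ O.labs) (σ : Perm (Fin n)) :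
    act (vact (K := ℂ) g σ) (O.linNrm a) = O.linNrm a := by
  classical
  have hF0 := O.F_ne_zero ha
  -- even permutations
  have heven : ∀ ρ : Perm (Fin n), Perm.sign ρ = 1 → act (vact (K := ℂ) g ρ) (O.linNrm a) = O.linNrm a := by
    intro ρ hρ
    rw [linNrm, act_map_nrm, act]
    have hmm : Multiset.map (fun q => nrm (vact (K := ℂ) g ρ q)) (linPart (O.F a)) =
        ((linPart (O.F a)).map (vact (K := ℂ) g ρ)).map nrm := by
      rw [Multiset.map_map]; rfl
    rw [hmm]
    refine (map_nrm_eq_of_rel ?_).symm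
    have h := linPart_map (vact (K := ℂ) g ρ) (fun q => by rw [vact_apply, totalDegree_rename_equiv]) hF0
    rw [hfixF a ρ hρ] at h
    exact h
  -- count invariance for every permutation
  refine act_eq_of_count _ (O.isNormalised_linNrm a) fun p hp => ?_
  obtain ⟨hp1, hpd⟩ := O.mem_linNrm ha hp
  obtain ⟨Y, hYc, hY⟩ := O.exists_support hg hinv hc1 hc2 hc3 hp1 (hpd.trans (O.F_dvd_Fall4 ha))
  -- correct an odd permutation by a transposition away from `Y`
  obtain ⟨ρ, hρs, hρp⟩ : ∃ ρ : Perm (Fin n), Perm.sign ρ = 1 ∧ vact (K := ℂ) g σ p = vact (K := ℂ) g ρ p := by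
    rcases Int.units_eq_one_or (Perm.sign σ) with hs | hs
    · exact ⟨σ, hs, rfl⟩
    · have hbig : 1 < (Finset.univ \ Y).card := by
        rw [Finset.card_sdiff_of_subset (Finset.subset_univ _), Finset.card_univ, Fintype.card_fin]; omega
      obtain ⟨u, hu, w, hw, huw⟩ := Finset.one_lt_card.1 hbig
      simp only [Finset.mem_sdiff, Finset.mem_univ, true_and] at hu hw
      refine ⟨σ * swap u w, by rw [Perm.sign_mul, Perm.sign_swap huw, hs]; decide, ?_⟩
      rw [map_mul, AlgEquiv.mul_apply, hY (swap u w) fun x hx => swap_apply_of_ne_of_ne (by rintro rfl; exact hu hx)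
        (by rintro rfl; exact hw hx)]
  rw [hρp]
  have := heven ρ hρs
  rw [← count_act (vact (K := ℂ) g ρ) (O.isNormalised_linNrm a) (fun q hq => hq) hp, this]

/-- **Each permutation of such an action multiplies `Π linPart (F a)` by a scalar.** [folklore] -/
theorem exists_C_mul_linProd {g : Perm (Fin n) →* Perm (Fin n × Fin n)} (hg : IsLocal g)
    (hfixF : ∀ a, ∀ ρ : Perm (Fin n), Perm.sign ρ = 1 → vact (K := ℂ) g ρ (O.F a) = O.F a)
    (hinv : ∀ ρ : Perm (Fin n), vact (K := ℂ) g ρ O.Fall4 = O.Fall4) {c : ℕ} (hc1 : 4 * (O.R.m * D) < n.choose (c + 2))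
    (hc2 : 4 * (c + 2) ≤ n) (hc3 : c + 7 ≤ n) {a : Fin O.R.m} (ha : a ∈ O.labs) (σ : Perm (Fin n)) :
    ∃ χ : ℂ, χ ≠ 0 ∧ vact (K := ℂ) g σ (linPart (O.F a)).prod = C χ * (linPart (O.F a)).prod := by
  have h := O.act_linNrm_eq hg hfixF hinv hc1 hc2 hc3 ha σ
  rw [linNrm, act_map_nrm, act] at h
  have hmm : Multiset.map (fun q => nrm (vact (K := ℂ) g σ q)) (linPart (O.F a)) =
      ((linPart (O.F a)).map (vact (K := ℂ) g σ)).map nrm := by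
    rw [Multiset.map_map]; rfl
  rw [hmm] at h
  have hrel := rel_of_map_nrm_eq h
  obtain ⟨w, hw⟩ := (prod_associated_of_rel hrel).symm
  obtain ⟨χ, hχ, hwχ⟩ := MvPolynomial.isUnit_iff_eq_C_of_isReduced.1 w.isUnit
  refine ⟨χ, hχ.ne_zero, ?_⟩
  rw [map_multiset_prod, ← hw, hwχ, mul_comm]

end OrbitDatum

end Summit.ValiantsHypothesis.ValiantsHypothesis.Theorems.OrbitRestorationQPMixingScale

end
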